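import Summits.CriticalPhenomena.PercolationContinuityZ3.Theorems.PercNearOneGluingNoHeavyLowerTailSwitchRelaxFinc28
import HarnessLib

/-!
# Finite-relaxation replay of the clean switching certificate `Finc28`: kernel checks at input types (pieces `checkAtY_0_13` … `checkAt_2`)

Support file (prover prim-masterthm-p1 gen 2; `--supports stmt-CriticalPhenomena-4575`).  No named facts, no sorries.  Split from
`…SwitchRelaxFinc28` only to keep each file's kernel time small.
-/

namespace Summit.CriticalPhenomena.PercolationContinuityZ3.Theorems

namespace SwitchRelax

namespace Finc28

/-- Kernel evaluation of the finite relaxation at input type `0`, `Y`-type `13`. [this work] -/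
theorem checkAtY_0_13 : certFinc28.checkAtY 0 13 = true := by decide +kernel

set_option maxHeartbeats 800000 in
/-- Kernel evaluation of the finite relaxation at input type `0`, `Y`-type `14`. [this work] -/
theorem checkAtY_0_14 : certFinc28.checkAtY 0 14 = true := by decide +kernel

/-- The check at input type `0` from its fifteen `Y`-type pieces. [this work] -/
theorem checkAt_0 : certFinc28.checkAt 0 = true :=
  Cert.checkAt_of_piecesY certFinc28 0 checkAtY_0_0 checkAtY_0_1 checkAtY_0_2 checkAtY_0_3 checkAtY_0_4 checkAtY_0_5 checkAtY_0_6 checkAtY_0_7 checkAtY_0_8 checkAtY_0_9 checkAtY_0_10 checkAtY_0_11 checkAtY_0_12 checkAtY_0_13 checkAtY_0_14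

/-- Kernel evaluation of the finite relaxation at input type `1`. [this work] -/
theorem checkAt_1 : certFinc28.checkAt 1 = true := by decide +kernel

/-- Kernel evaluation of the finite relaxation at input type `2`. [this work] -/
theorem checkAt_2 : certFinc28.checkAt 2 = true := by decide +kernel

end Finc28

end SwitchRelax

end Summit.CriticalPhenomena.PercolationContinuityZ3.Theorems
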